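import Summits.ResolutionOfSingularities.ResolutionOfSingularities.Theorems.HilbertSamuelEliminationCampaignW42OracleLocalCJS
import Literature.AlgebraicGeometry.Resolution.SigmaMaxEliminationInDim
import HarnessLib

/-!
# Campaign W4.2 (crux chain w42, stmt-ResolutionOfSingularities-18506 / -19249): the CJS scope passes to OPEN SUBSCHEMES,
# and the ABSOLUTE locality `OracleLocal` of the local oracle of CJS Thm. 1.2

OURS (cell `res-hironaka`, rung L ★L-G4, slot W4.2; statements about the route's own objects; NOT statements of
the manuscript under review [claim: Hironaka2017, status: under-review]; AI typing, weaker than expert review).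
res-L1-w42-plan-1 RULINGS v3.10-1 (H) (HOME/STATUS 2026-08-27T06:48:59Z): «𝓞 OF RECORD: `OracleLocalOn CJSScope` … the
ABSOLUTE `OracleLocal R` is WELCOME as a corollary because scope inheritance to opens is one line each in the tree …
export the inheritance lemma `CJSScope.of_isOpenImmersion` either way so consumers cite it». Companion of
`…CampaignW42OracleLocal.lean` (p507217) and `…CampaignW42OracleLocalCJS.lean` (p508637).

* `isNoetherian_of_isOpenImmersion`, `topologicalKrullDim_le_of_isOpenImmersion` — an open subscheme of a Noetherian
  scheme is Noetherian (locally Noetherian: Mathlib `isLocallyNoetherian_of_isOpenImmersion`; quasi-compact: its image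
  is a subset of a Noetherian space); its dimension does not exceed that of the ambient scheme (inducing maps,
  Mathlib `Topology.IsInducing.topologicalKrullDim_le`).
* **`CJSScope.of_isOpenImmersion`** — reduced ∧ excellent ∧ Noetherian ∧ `dim ≤ 2` passes to open subschemes
  (reducedness: Mathlib `isReduced_of_isOpenImmersion`; excellence: tree `Scheme.IsExcellent.of_locallyOfFiniteType`,
  an open immersion being locally of finite type).
* `OracleLocalOn.oracleLocal` — a scoped-local oracle that answers ONLY on a class stable under open subschemes is
  absolutely local; `oracleOf_oracleLocal` — the oracle of an assignment compatible with restriction-then-pruning on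
  such a class is absolutely local.
* **`exists_localOracle_abs`** — from the named fact `CossartJannsenSaito2020SequenceFunctorial` (CJS Thm. 1.2 with
  its Zariski-local functoriality): a functional, admissible, ABSOLUTELY LOCAL (`OracleLocal`) oracle answering on
  every reduced excellent Noetherian scheme of dimension `≤ 2` (and it is also `OracleLocalOn CJSScope`).

Nothing here is a route item or a registration. [folklore]
-/

noncomputable section

set_option linter.dupNamespace false -- mandated namespace of this single-conjunct summit

open CategoryTheory AlgebraicGeometry TopologicalSpace Topology

namespace Summit.ResolutionOfSingularities.ResolutionOfSingularities.Theorems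

namespace CampaignW42

open Literature.AlgebraicGeometry.Resolution

universe u

/-! ## Open subschemes of Noetherian schemes -/

/-- **An open subscheme of a Noetherian scheme is Noetherian**: locally Noetherian by restriction of the affine
charts (Mathlib `isLocallyNoetherian_of_isOpenImmersion`), and quasi-compact because its underlying space embeds
into the Noetherian topological space of `S`, all of whose subsets are compact. [folklore] -/
theorem isNoetherian_of_isOpenImmersion {U S : Scheme.{u}} (j : U ⟶ S) [IsOpenImmersion j] [IsNoetherian S] :
    IsNoetherian U :=
  haveI : IsLocallyNoetherian U := isLocallyNoetherian_of_isOpenImmersion j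
  haveI : CompactSpace U :=
    ⟨(j.isOpenEmbedding.isInducing.isCompact_iff).mpr (NoetherianSpace.isCompact _)⟩
  { }

/-- **The dimension of an open subscheme does not exceed the dimension of the scheme** (an open immersion induces
the topology; Mathlib `Topology.IsInducing.topologicalKrullDim_le`). [folklore] -/
theorem topologicalKrullDim_le_of_isOpenImmersion {U S : Scheme.{u}} (j : U ⟶ S) [IsOpenImmersion j] :
    topologicalKrullDim U ≤ topologicalKrullDim S :=
  j.isOpenEmbedding.isInducing.topologicalKrullDim_le

/-- [OURS · L1 W4.2] **The CJS scope passes to open subschemes**: if `S` is reduced, excellent, Noetherian of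
dimension `≤ 2` and `j : U ⟶ S` is an open immersion, then so is `U` (reduced: Mathlib `isReduced_of_isOpenImmersion`;
excellent: `Scheme.IsExcellent.of_locallyOfFiniteType`, an open immersion is locally of finite type; Noetherian and
`dim U ≤ dim S ≤ 2`: the two lemmas above). The inheritance lemma consumers cite (res-L1-w42-plan-1 RULINGS
v3.10-1 (H)). [folklore] -/
theorem CJSScope.of_isOpenImmersion {U S : Scheme.{u}} (j : U ⟶ S) [IsOpenImmersion j] (hS : CJSScope S) :
    CJSScope U := by
  obtain ⟨hN, hR, hE, hd⟩ := hS
  haveI := hN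
  haveI := hR
  haveI : IsNoetherian U := isNoetherian_of_isOpenImmersion j
  exact ⟨inferInstance, isReduced_of_isOpenImmersion j, Scheme.IsExcellent.of_locallyOfFiniteType j hE,
    (topologicalKrullDim_le_of_isOpenImmersion j).trans hd⟩

/-! ## From scoped to absolute locality -/

/-- **Scoped locality on a class stable under open subschemes, for an oracle answering only on that class, is
absolute locality.** [folklore] -/
theorem OracleLocalOn.oracleLocal {𝒞 : Scheme.{u} → Prop} {R : ∀ S : Scheme.{u}, CentreSeq S → Prop}
    (h : OracleLocalOn 𝒞 R) (hscope : ∀ (S : Scheme.{u}) (t : CentreSeq S), R S t → 𝒞 S)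
    (hopen : ∀ (S U : Scheme.{u}) (j : U ⟶ S) [IsOpenImmersion j], 𝒞 S → 𝒞 U) : OracleLocal R :=
  fun S U j _ t ht => h j (hscope S t ht) (hopen S U j (hscope S t ht)) t ht

/-- **The oracle of an assignment compatible with restriction-then-pruning, on a class stable under open
subschemes, is absolutely local.** [folklore] -/
theorem oracleOf_oracleLocal (𝒞 : Scheme.{u} → Prop) (𝓢 : ∀ S : Scheme.{u}, 𝒞 S → CentreSeq S)
    (hloc : ∀ (S U : Scheme.{u}) (j : U ⟶ S) [IsOpenImmersion j] (hS : 𝒞 S) (hU : 𝒞 U),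
      𝓢 U hU = ((𝓢 S hS).restrict j).prune)
    (hopen : ∀ (S U : Scheme.{u}) (j : U ⟶ S) [IsOpenImmersion j], 𝒞 S → 𝒞 U) :
    OracleLocal (oracleOf 𝒞 𝓢) :=
  (oracleOf_localOn 𝒞 𝓢 hloc).oracleLocal (fun _ _ ht => oracleOf_scope ht) hopen

/-- **The calibration with ABSOLUTE locality, generic form**: an assignment on a class stable under open subschemes,
with admissible values and compatible with restriction-then-pruning, yields a functional, admissible, absolutely
local oracle answering on the class (and local on the class). [folklore] -/
theorem exists_localOracle_abs_of (𝒞 : Scheme.{u} → Prop) (𝓢 : ∀ S : Scheme.{u}, 𝒞 S → CentreSeq S)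
    (hadm : ∀ (S : Scheme.{u}) (h : 𝒞 S), (𝓢 S h).AllPermissible ∧
      (𝓢 S h).CentresOver (Scheme.regularLocus S)ᶜ ∧
        Literature.AlgebraicGeometry.Resolution.Scheme.IsRegular (𝓢 S h).top)
    (hloc : ∀ (S U : Scheme.{u}) (j : U ⟶ S) [IsOpenImmersion j] (hS : 𝒞 S) (hU : 𝒞 U),
      𝓢 U hU = ((𝓢 S hS).restrict j).prune)
    (hopen : ∀ (S U : Scheme.{u}) (j : U ⟶ S) [IsOpenImmersion j], 𝒞 S → 𝒞 U) :
    ∃ R : ∀ S : Scheme.{u}, CentreSeq S → Prop,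
      OracleFunctional R ∧ OracleAdmissible R ∧ OracleLocal R ∧ OracleLocalOn 𝒞 R ∧
        ∀ S : Scheme.{u}, 𝒞 S → ∃ t, R S t :=
  ⟨oracleOf 𝒞 𝓢, oracleOf_functional 𝒞 𝓢, oracleOf_admissible 𝒞 𝓢 hadm, oracleOf_oracleLocal 𝒞 𝓢 hloc hopen,
    oracleOf_localOn 𝒞 𝓢 hloc, oracleOf_answers 𝒞 𝓢⟩

/-- [OURS · L1 W4.2] **THE CALIBRATION BY AN ABSOLUTELY LOCAL ORACLE, from CJS Thm. 1.2 (functorial form).** From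
the named fact `CossartJannsenSaito2020SequenceFunctorial`: a functional, admissible oracle `R` with `OracleLocal R`
(compatible with EVERY open immersion: it answers only on `CJSScope`, which passes to open subschemes,
`CJSScope.of_isOpenImmersion`), also `OracleLocalOn CJSScope R`, answering on every reduced excellent Noetherian scheme
of dimension `≤ 2`. [cite: CossartJannsenSaito2020, Thm. 1.2 (p. 5)] -/
theorem exists_localOracle_abs (hF : CossartJannsenSaito2020SequenceFunctorial.{u}) :
    ∃ R : ∀ S : Scheme.{u}, CentreSeq S → Prop,
      OracleFunctional R ∧ OracleAdmissible R ∧ OracleLocal R ∧ OracleLocalOn CJSScope R ∧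
        ∀ S : Scheme.{u}, CJSScope S → ∃ t, R S t := by
  obtain ⟨𝓢, h𝓢, hloc⟩ := hF
  refine exists_localOracle_abs_of CJSScope (fun S h => @𝓢 S h.1 h.2.1 h.2.2.1 h.2.2.2)
    (fun S h => ?_) (fun S U j _ hS hU => ?_) (fun S U j _ hS => CJSScope.of_isOpenImmersion j hS)
  · have h' := @h𝓢 S h.1 h.2.1 h.2.2.1 h.2.2.2
    exact ⟨h'.1, h'.2.1.centresOver, h'.2.2⟩
  · exact @hloc S U hS.1 hS.2.1 hU.1 hU.2.1 hS.2.2.1 hS.2.2.2 hU.2.2.1 hU.2.2.2 j _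

/-- [OURS · L1 W4.2] **… and the absolutely local oracle answers along `S(X, ν)` in dimension three** (packaged with
the (H2) adapter `answers_of_dim_le_three_of_scope`). [cite: CossartJannsenSaito2020, Thm. 1.2 (p. 5), Rem. 6.29 (1)] -/
theorem exists_localOracle_abs_answers (hF : CossartJannsenSaito2020SequenceFunctorial.{u}) :
    ∃ R : ∀ S : Scheme.{u}, CentreSeq S → Prop,
      OracleFunctional R ∧ OracleAdmissible R ∧ OracleLocal R ∧
        ∀ (p N : ℕ) (ν : ℕ → ℕ) {X : Scheme.{u}} [IsLocallyNoetherian X] {x : X},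
          IsIsolatedOrigin p N ν X x → ν ≠ Literature.RingTheory.HilbertSamuel.iterPSum N
            Literature.RingTheory.HilbertSamuel.Phi →
          topologicalKrullDim X ≤ ((3 : ℕ) : WithBot ℕ∞) →
          ∀ (s : CentreSeq X), s.IsCanonicalRun R N ν →
            ∀ (Z : Set s.top) (hZ : IsClosed Z), Z ⊆ Scheme.hsStratum s.top N ν → Z.Nonempty →
              ∃ t, R (Scheme.IdealSheafData.vanishingIdeal ⟨Z, hZ⟩).subscheme t := by
  obtain ⟨R, hRf, hRa, hRl, -, hRt⟩ := exists_localOracle_abs hF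
  exact ⟨R, hRf, hRa, hRl, fun _ _ _ _ _ _ hX hν hdim3 s hs Z hZ hZν hne =>
    answers_of_dim_le_three_of_scope hRa hRt hX hν hdim3 s hs Z hZ hZν hne⟩

end CampaignW42

end Summit.ResolutionOfSingularities.ResolutionOfSingularities.Theorems

end
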